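/- Free lead seat `ym-line-cbag-p1` (prover-ym-line-cbag-p1-g20-0; own crux `BoxFloorAllGroups` stmt-QuantumFields-22254 CLOSED) on the
planner-of-record's LINE 5, route `HankelDensitySplitting`: REGISTERED STUB 4 `stub_floorOfDoors : FloorOfDoors` of the birth skeleton of crux
`HankelDensityFloor` (stmt-QuantumFields-26618).  Pure real analysis.  RECORD-type material (node `LatticeNonFreezing`); the Yang–Mills mass gap
is NOT proved by anything here, and the crux stays open (doors 1–3). -/
import Summits.QuantumFields.YangMills.Theorems.HankelDensitySplittingHankelDensityFloorDefs
import Summits.QuantumFields.YangMills.Theorems.DirichletWindowXiDivergesOfFixedDistance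

/-!
# Route `HankelDensitySplitting`, crux `HankelDensityFloor` (stmt-QuantumFields-26618): stub 4 `FloorOfDoors`

`FloorOfDoors := HankelFixedDistanceLower → HankelNearUpper → HankelLogConvex → HankelDensityFloor` (objects of the registered skeleton,
`HankelDensitySplittingHankelDensityFloorDefs`): the fixed-distance floor `A/(β² n⁸) ≤ F_μ(n)` (`n ≥ n₀`, eventually in `β`), the near ceiling
`F_μ(1) ≤ B/β²` and the Hankel log-convexity of `n ↦ F_μ(n)` (`n ≥ 1`) give, for every `ε > 0`, constants `c > 0`, `β₁` — `c` INDEPENDENT of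
`β` and of the limit state — with `c β⁻² e^{−ε n} ≤ F_μ(n)` for all `β ≥ β₁`, `μ ∈ infiniteVolumeLimitPoints r.ρ β`, `n ≥ 1`.

Proof: the chord template of route `DirichletWindow` (`xiChord_exp_lower`, `exists_nat_chord_small`; item 8943 `xiDivergesOfFixedDistance_proof`)
run for the shifted sequence `a j := F_μ(j+1)`; the two factors `β⁻²` cancel in the chord slope, so the amplitude is `A/(n+1)⁸ · β⁻²` with `n`
chosen from `A`, `B`, `ε` alone.  NOT the Yang–Mills mass gap; the crux `HankelDensityFloor` is not proved here (doors 1–3 are open).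
-/

set_option autoImplicit false

noncomputable section

open MeasureTheory
open Literature.MathematicalPhysics.QuantumLattice
open Literature.MathematicalPhysics.QuantumFieldTheory

namespace Summit.QuantumFields.YangMills.Theorems.HankelDensitySplitting

/-! ### Stub 4: the doors lemma -/

open Real Filter Topology in
/-- **STUB 4 of the registered skeleton of crux `HankelDensityFloor` (stmt-QuantumFields-26618), proved: `FloorOfDoors`.**
Fixed-distance floor `A/(β² n⁸) ≤ F(n)` (`n ≥ n₀`, eventually in `β`), near ceiling `F(1) ≤ B/β²` and Hankel log-convexity of `n ↦ F(n)`
(`n ≥ 1`) give, for every `ε > 0`, constants `c > 0`, `β₁` with `c β⁻² e^{−ε n} ≤ F_μ(n)` for all `β ≥ β₁`, all limit states `μ`, all `n ≥ 1`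
— with `c` INDEPENDENT of `β` and `μ` (the two `β⁻²` cancel in the chord slope).  Proof: the chord template `xiChord_exp_lower` of route
`DirichletWindow` for `a j := F(j+1)`: pick `n ≥ max n₀ 2` with `(log B' − log A + 8 log 2 + 8 log n)/(n − 1) < ε` (`B' = max B 1`,
`exists_nat_chord_small`); for `β ≥ max(β_{n+1}, β₁', 1)` the slope `m = (log a 1 − log a n)/(n−1)` is `≤ ε` because `a 1 ≤ a 0 = F(1) ≤ B'/β²`
and `a n = F(n+1) ≥ A/(β² (n+1)⁸)` (`log (n+1) ≤ log 2 + log n`), and `F(j+1) = a j ≥ a n e^{−m j} ≥ (A/(n+1)⁸) β⁻² e^{−ε (j+1)}`.  So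
`c = A/(n+1)⁸`.  Pure real analysis; NOT the Yang–Mills mass gap, and not the crux (doors 1–3 stay open). -/
theorem stub_floorOfDoors : FloorOfDoors := by
  intro h₁ h₂ h₃ G _ _ _ _ _ _ hG r ε hε
  obtain ⟨A, n₀, hA, -, hlow⟩ := h₁ G hG r
  obtain ⟨B, β₁', -, hup⟩ := h₂ G hG r
  obtain ⟨n, hn₀, hn2, hn⟩ :=
    exists_nat_chord_small (Real.log (max B 1) - Real.log A + 8 * Real.log 2) ε hε n₀
  obtain ⟨βn, hβn⟩ := hlow (n + 1) (by omega)
  refine ⟨A / ((n + 1 : ℕ) : ℝ) ^ 8, max (max βn β₁') 1, by positivity, fun β hβ μ hμ k hk => ?_⟩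
  have hββn : βn ≤ β := le_trans ((le_max_left _ _).trans (le_max_left _ _)) hβ
  have hββ₁ : β₁' ≤ β := le_trans ((le_max_right _ _).trans (le_max_left _ _)) hβ
  have hβ1 : 1 ≤ β := le_trans (le_max_right _ _) hβ
  have hβ0 : 0 < β := by linarith
  -- the Hankel sequence `a j = F(j+1)`
  set a : ℕ → ℝ := fun j => hF r.ρ μ (j + 1) with ha
  have hax := h₃ G hG r β hβ0.le μ hμ
  have hmono : ∀ j, a (j + 1) ≤ a j := fun j => (hax (j + 1) (by omega)).2.1
  have hlc : ∀ j, a (j + 2) ^ 2 ≤ a (j + 1) * a (j + 3) := fun j => (hax (j + 2) (by omega)).2.2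
  have hlowβ : A / (β ^ 2 * ((n + 1 : ℕ) : ℝ) ^ 8) ≤ a n := hβn β hββn μ hμ
  have hupβ : a 0 ≤ B / β ^ 2 := hup β hββ₁ μ hμ
  have hn1pos : (0 : ℝ) < ((n + 1 : ℕ) : ℝ) := by positivity
  have hApos : 0 < A / (β ^ 2 * ((n + 1 : ℕ) : ℝ) ^ 8) := by positivity
  have hpos : 0 < a n := hApos.trans_le hlowβ
  obtain ⟨hm0, hchord⟩ := xiChord_exp_lower a n hn2 hmono hlc hpos
  set m : ℝ := (Real.log (a 1) - Real.log (a n)) / ((n : ℝ) - 1) with hm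
  -- the slope is at most `ε`
  have hn1 : (0 : ℝ) < (n : ℝ) - 1 := by
    have : (2 : ℝ) ≤ n := by exact_mod_cast hn2
    linarith
  have hB' : (0 : ℝ) < max B 1 := lt_of_lt_of_le one_pos (le_max_right _ _)
  have ha1pos : 0 < a 1 := by
    have h' : 0 < a n * Real.exp (-(m * ((1 : ℕ) : ℝ))) := mul_pos hpos (Real.exp_pos _)
    exact h'.trans_le (hchord 1)
  have hlogup : Real.log (a 1) ≤ Real.log (max B 1) - 2 * Real.log β := by
    have h01 : a 1 ≤ max B 1 / β ^ 2 := by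
      calc a 1 ≤ a 0 := hmono 0
        _ ≤ B / β ^ 2 := hupβ
        _ ≤ max B 1 / β ^ 2 := by gcongr; exact le_max_left _ _
    have := Real.log_le_log ha1pos h01
    rw [Real.log_div hB'.ne' (by positivity), Real.log_pow] at this
    push_cast at this
    linarith
  have hlogdown : Real.log A - 2 * Real.log β - 8 * Real.log ((n + 1 : ℕ) : ℝ) ≤ Real.log (a n) := by
    have := Real.log_le_log hApos hlowβ
    rw [Real.log_div hA.ne' (by positivity), Real.log_mul (by positivity) (by positivity),
      Real.log_pow, Real.log_pow] at this
    push_cast at this ⊢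
    linarith
  have hlogn1 : Real.log ((n + 1 : ℕ) : ℝ) ≤ Real.log 2 + Real.log n := by
    have hn0 : (0 : ℝ) < n := by exact_mod_cast (show 0 < n by omega)
    rw [← Real.log_mul (by norm_num) hn0.ne']
    exact Real.log_le_log hn1pos (by push_cast; linarith)
  have hnum : Real.log (a 1) - Real.log (a n) ≤
      Real.log (max B 1) - Real.log A + 8 * Real.log 2 + 8 * Real.log n := by linarith
  have hmε : m ≤ ε := le_of_lt (lt_of_le_of_lt (div_le_div_of_nonneg_right hnum hn1.le) hn)
  -- the floor at `k = j + 1`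
  obtain ⟨j, rfl⟩ : ∃ j, k = j + 1 := ⟨k - 1, by omega⟩
  have hexp : Real.exp (-(ε * ((j + 1 : ℕ) : ℝ))) ≤ Real.exp (-(m * (j : ℝ))) := by
    refine Real.exp_le_exp.2 ?_
    have hj : (0 : ℝ) ≤ j := Nat.cast_nonneg j
    have : m * (j : ℝ) ≤ ε * (j : ℝ) := mul_le_mul_of_nonneg_right hmε hj
    push_cast
    nlinarith [hε.le]
  have hc : A / ((n + 1 : ℕ) : ℝ) ^ 8 / β ^ 2 = A / (β ^ 2 * ((n + 1 : ℕ) : ℝ) ^ 8) := by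
    rw [div_div, mul_comm]
  calc A / ((n + 1 : ℕ) : ℝ) ^ 8 / β ^ 2 * Real.exp (-(ε * ((j + 1 : ℕ) : ℝ)))
      ≤ a n * Real.exp (-(m * (j : ℝ))) := by
        rw [hc]
        exact mul_le_mul hlowβ hexp (Real.exp_pos _).le hpos.le
    _ ≤ a j := hchord j
    _ = hF r.ρ μ (j + 1) := rfl

end Summit.QuantumFields.YangMills.Theorems.HankelDensitySplitting

end
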